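import Summits.Ventures.YMGap.RobustBall.MassGapOnBallZdWRowsSU3
import Summits.Ventures.YMGap.RobustBall.MassGapOnBallZdWRowsSU3Dim3
import Summits.Ventures.YMGap.RobustBall.MassGapOnBallZdWRowsSUNCells
import Summits.Ventures.YMGap.RobustBall.TierTwoFrontierSUN
import Summits.Ventures.YMGap.RobustBall.PeriodisedDLRSummable
import HarnessLib

/-!
# Venture YMGap, track ROBUST-BALL (Y2) — «C-ONE-W» CELLS FOR `SU(3)` AND FOR EVERY `N`: on the tier-2 balls of the hypothesis-free
# `SU(3)` cells (`ℤ⁴`, `ℤ³`) and of the every-`N` cells, the van Hove (periodised torus) limit of every member IS its one DLR state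

HONEST FRAMING. WHAT THIS IS: a venture file (cell `pub-ymgap`, track Y2 ROBUST-BALL, seat ds-2): one-line consequences of
`oneState_onBallZdW` / `exists_limitState_onBallZdW` (`PeriodisedDLRSummable.lean`) and the landed tier-2 mass-gap cells
`su3_massGapOnBallZdW_starPV_<cell>` (`ℤ⁴`: (1/8,.262) (1/6,.211) (1/5,.169) (1/4,.102) (3/10,.028)),
`su3_massGapOnBallZdW_dim3_starPV_<cell>` (`ℤ³`: (1/4,.213) (1/3,.144) (2/5,.084) (9/20,.037)) and the every-`N` cells
`suN_massGapOnBallZdW_star_<64|48|40|36>` / `suN_massGapOnBallZdW_dim3_star_<40|32|28|24>`: for EVERY member `W` of the cell's ball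
`MemBallZdW (1/100) (2ε) ε` (gauge-invariant summable perturbations of Wilson of ARBITRARY range), EVERY infinite-volume limit state of
the perturbed torus states of its periodised family (`periodisedFamilyS`, rb-p2's `perturbedLimitPoints`, tree coupling `N·β`) IS the one
DLR state, and such limit states exist; the same on the FRONTIER cells of `TierTwoFrontierSUN.lean` (`SU(3)`: (31/100,.01) (63/200,.002)
(317/1000,.0001); every `N`: 't Hooft (1/35,.008) (2/69,.002) (7/240,.0001)). WHAT THIS IS NOT: strong-coupling LATTICE statements; no rate of convergence for the van Hove
limit; nothing about the continuum, a transfer-matrix gap or the Millennium problem.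
-/

noncomputable section

open MeasureTheory Function Finset Real
open scoped NNReal
open Literature.Probability.LatticeModels
open Literature.MathematicalPhysics.QuantumLattice hiding torusNorm
open Literature.MathematicalPhysics.QuantumFieldTheory hiding ZdEdge
open Summit.Ventures.YMGap.DSWindowZd

namespace Summit.Ventures.YMGap.RobustBall

variable {N : ℕ}

/-! ### `SU(3)`, `ℤ⁴` (hypothesis-free PV-variance cells) -/

/-- **VAN HOVE = THE ONE STATE**, `SU(3)`, `ℤ⁴`, cell `β_W = 1 / 8` ('t Hooft `1 / 72`, tree coupling `1 / 24`): for every member of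
`MemBallZdW (1/100) (131 / 250) (131 / 500)`, every infinite-volume limit state of the perturbed torus states of its periodised family equals every
DLR state, and such limit states exist. [folklore] -/
theorem su3_vanHove_oneState_starPV_oneEighth :
    ∀ (W : Potential (ZdEdge 4) (SUN 3)) (hW : MemBallZdW (1 / 100) (131 / 250) (131 / 500) W),
      (∀ μ ∈ perturbedLimitPoints (1 / 24) (periodisedFamilyS W hW.dependsOn hW.gaugeInvariant hW.continuous),
        ∀ ν ∈ perturbedGibbsMeasuresS (d := 4) (fundamentalRep (Fin 3)) (1 / 24) W, μ = ν) ∧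
      ∃ μ ∈ perturbedLimitPoints (1 / 24) (periodisedFamilyS W hW.dependsOn hW.gaugeInvariant hW.continuous),
        μ ∈ perturbedGibbsMeasuresS (d := 4) (fundamentalRep (Fin 3)) (1 / 24) W := by
  intro W hW
  have e : ((3 : ℕ) : ℝ) * (1 / 72 : ℝ) = 1 / 24 := by norm_num
  refine ⟨fun μ hμ ν hν => ?_, exists_limitState_onBallZdW _ hW⟩
  rw [← e] at hμ hν
  exact oneState_onBallZdW su3_massGapOnBallZdW_starPV_oneEighth hW hμ hν

/-- **VAN HOVE = THE ONE STATE**, `SU(3)`, `ℤ⁴`, cell `β_W = 1 / 6` ('t Hooft `1 / 54`, tree coupling `1 / 18`): for every member of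
`MemBallZdW (1/100) (211 / 500) (211 / 1000)`, every infinite-volume limit state of the perturbed torus states of its periodised family equals every
DLR state, and such limit states exist. [folklore] -/
theorem su3_vanHove_oneState_starPV_oneSixth :
    ∀ (W : Potential (ZdEdge 4) (SUN 3)) (hW : MemBallZdW (1 / 100) (211 / 500) (211 / 1000) W),
      (∀ μ ∈ perturbedLimitPoints (1 / 18) (periodisedFamilyS W hW.dependsOn hW.gaugeInvariant hW.continuous),
        ∀ ν ∈ perturbedGibbsMeasuresS (d := 4) (fundamentalRep (Fin 3)) (1 / 18) W, μ = ν) ∧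
      ∃ μ ∈ perturbedLimitPoints (1 / 18) (periodisedFamilyS W hW.dependsOn hW.gaugeInvariant hW.continuous),
        μ ∈ perturbedGibbsMeasuresS (d := 4) (fundamentalRep (Fin 3)) (1 / 18) W := by
  intro W hW
  have e : ((3 : ℕ) : ℝ) * (1 / 54 : ℝ) = 1 / 18 := by norm_num
  refine ⟨fun μ hμ ν hν => ?_, exists_limitState_onBallZdW _ hW⟩
  rw [← e] at hμ hν
  exact oneState_onBallZdW su3_massGapOnBallZdW_starPV_oneSixth hW hμ hν

/-- **VAN HOVE = THE ONE STATE**, `SU(3)`, `ℤ⁴`, cell `β_W = 1 / 5` ('t Hooft `1 / 45`, tree coupling `1 / 15`): for every member of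
`MemBallZdW (1/100) (169 / 500) (169 / 1000)`, every infinite-volume limit state of the perturbed torus states of its periodised family equals every
DLR state, and such limit states exist. [folklore] -/
theorem su3_vanHove_oneState_starPV_oneFifth :
    ∀ (W : Potential (ZdEdge 4) (SUN 3)) (hW : MemBallZdW (1 / 100) (169 / 500) (169 / 1000) W),
      (∀ μ ∈ perturbedLimitPoints (1 / 15) (periodisedFamilyS W hW.dependsOn hW.gaugeInvariant hW.continuous),
        ∀ ν ∈ perturbedGibbsMeasuresS (d := 4) (fundamentalRep (Fin 3)) (1 / 15) W, μ = ν) ∧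
      ∃ μ ∈ perturbedLimitPoints (1 / 15) (periodisedFamilyS W hW.dependsOn hW.gaugeInvariant hW.continuous),
        μ ∈ perturbedGibbsMeasuresS (d := 4) (fundamentalRep (Fin 3)) (1 / 15) W := by
  intro W hW
  have e : ((3 : ℕ) : ℝ) * (1 / 45 : ℝ) = 1 / 15 := by norm_num
  refine ⟨fun μ hμ ν hν => ?_, exists_limitState_onBallZdW _ hW⟩
  rw [← e] at hμ hν
  exact oneState_onBallZdW su3_massGapOnBallZdW_starPV_oneFifth hW hμ hν

/-- **VAN HOVE = THE ONE STATE**, `SU(3)`, `ℤ⁴`, cell `β_W = 1 / 4` ('t Hooft `1 / 36`, tree coupling `1 / 12`): for every member of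
`MemBallZdW (1/100) (51 / 250) (51 / 500)`, every infinite-volume limit state of the perturbed torus states of its periodised family equals every
DLR state, and such limit states exist. [folklore] -/
theorem su3_vanHove_oneState_starPV_oneQuarter :
    ∀ (W : Potential (ZdEdge 4) (SUN 3)) (hW : MemBallZdW (1 / 100) (51 / 250) (51 / 500) W),
      (∀ μ ∈ perturbedLimitPoints (1 / 12) (periodisedFamilyS W hW.dependsOn hW.gaugeInvariant hW.continuous),
        ∀ ν ∈ perturbedGibbsMeasuresS (d := 4) (fundamentalRep (Fin 3)) (1 / 12) W, μ = ν) ∧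
      ∃ μ ∈ perturbedLimitPoints (1 / 12) (periodisedFamilyS W hW.dependsOn hW.gaugeInvariant hW.continuous),
        μ ∈ perturbedGibbsMeasuresS (d := 4) (fundamentalRep (Fin 3)) (1 / 12) W := by
  intro W hW
  have e : ((3 : ℕ) : ℝ) * (1 / 36 : ℝ) = 1 / 12 := by norm_num
  refine ⟨fun μ hμ ν hν => ?_, exists_limitState_onBallZdW _ hW⟩
  rw [← e] at hμ hν
  exact oneState_onBallZdW su3_massGapOnBallZdW_starPV_oneQuarter hW hμ hν

/-- **VAN HOVE = THE ONE STATE**, `SU(3)`, `ℤ⁴`, cell `β_W = 3 / 10` ('t Hooft `1 / 30`, tree coupling `1 / 10`): for every member of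
`MemBallZdW (1/100) (7 / 125) (7 / 250)`, every infinite-volume limit state of the perturbed torus states of its periodised family equals every
DLR state, and such limit states exist. [folklore] -/
theorem su3_vanHove_oneState_starPV_threeTenths :
    ∀ (W : Potential (ZdEdge 4) (SUN 3)) (hW : MemBallZdW (1 / 100) (7 / 125) (7 / 250) W),
      (∀ μ ∈ perturbedLimitPoints (1 / 10) (periodisedFamilyS W hW.dependsOn hW.gaugeInvariant hW.continuous),
        ∀ ν ∈ perturbedGibbsMeasuresS (d := 4) (fundamentalRep (Fin 3)) (1 / 10) W, μ = ν) ∧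
      ∃ μ ∈ perturbedLimitPoints (1 / 10) (periodisedFamilyS W hW.dependsOn hW.gaugeInvariant hW.continuous),
        μ ∈ perturbedGibbsMeasuresS (d := 4) (fundamentalRep (Fin 3)) (1 / 10) W := by
  intro W hW
  have e : ((3 : ℕ) : ℝ) * (1 / 30 : ℝ) = 1 / 10 := by norm_num
  refine ⟨fun μ hμ ν hν => ?_, exists_limitState_onBallZdW _ hW⟩
  rw [← e] at hμ hν
  exact oneState_onBallZdW su3_massGapOnBallZdW_starPV_threeTenths hW hμ hν

/-! ### `SU(3)`, `ℤ³` -/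

/-- **VAN HOVE = THE ONE STATE**, `SU(3)`, `ℤ³`, cell `β_W = 1 / 4` ('t Hooft `1 / 36`, tree coupling `1 / 12`): for every member of
`MemBallZdW (1/100) (213 / 500) (213 / 1000)`, every infinite-volume limit state of the perturbed torus states of its periodised family equals every
DLR state, and such limit states exist. [folklore] -/
theorem su3_vanHove_oneState_dim3_starPV_oneQuarter :
    ∀ (W : Potential (ZdEdge 3) (SUN 3)) (hW : MemBallZdW (1 / 100) (213 / 500) (213 / 1000) W),
      (∀ μ ∈ perturbedLimitPoints (1 / 12) (periodisedFamilyS W hW.dependsOn hW.gaugeInvariant hW.continuous),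
        ∀ ν ∈ perturbedGibbsMeasuresS (d := 3) (fundamentalRep (Fin 3)) (1 / 12) W, μ = ν) ∧
      ∃ μ ∈ perturbedLimitPoints (1 / 12) (periodisedFamilyS W hW.dependsOn hW.gaugeInvariant hW.continuous),
        μ ∈ perturbedGibbsMeasuresS (d := 3) (fundamentalRep (Fin 3)) (1 / 12) W := by
  intro W hW
  have e : ((3 : ℕ) : ℝ) * (1 / 36 : ℝ) = 1 / 12 := by norm_num
  refine ⟨fun μ hμ ν hν => ?_, exists_limitState_onBallZdW _ hW⟩
  rw [← e] at hμ hν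
  exact oneState_onBallZdW su3_massGapOnBallZdW_dim3_starPV_oneQuarter hW hμ hν

/-- **VAN HOVE = THE ONE STATE**, `SU(3)`, `ℤ³`, cell `β_W = 1 / 3` ('t Hooft `1 / 27`, tree coupling `1 / 9`): for every member of
`MemBallZdW (1/100) (36 / 125) (18 / 125)`, every infinite-volume limit state of the perturbed torus states of its periodised family equals every
DLR state, and such limit states exist. [folklore] -/
theorem su3_vanHove_oneState_dim3_starPV_oneThird :
    ∀ (W : Potential (ZdEdge 3) (SUN 3)) (hW : MemBallZdW (1 / 100) (36 / 125) (18 / 125) W),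
      (∀ μ ∈ perturbedLimitPoints (1 / 9) (periodisedFamilyS W hW.dependsOn hW.gaugeInvariant hW.continuous),
        ∀ ν ∈ perturbedGibbsMeasuresS (d := 3) (fundamentalRep (Fin 3)) (1 / 9) W, μ = ν) ∧
      ∃ μ ∈ perturbedLimitPoints (1 / 9) (periodisedFamilyS W hW.dependsOn hW.gaugeInvariant hW.continuous),
        μ ∈ perturbedGibbsMeasuresS (d := 3) (fundamentalRep (Fin 3)) (1 / 9) W := by
  intro W hW
  have e : ((3 : ℕ) : ℝ) * (1 / 27 : ℝ) = 1 / 9 := by norm_num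
  refine ⟨fun μ hμ ν hν => ?_, exists_limitState_onBallZdW _ hW⟩
  rw [← e] at hμ hν
  exact oneState_onBallZdW su3_massGapOnBallZdW_dim3_starPV_oneThird hW hμ hν

/-- **VAN HOVE = THE ONE STATE**, `SU(3)`, `ℤ³`, cell `β_W = 2 / 5` ('t Hooft `2 / 45`, tree coupling `2 / 15`): for every member of
`MemBallZdW (1/100) (21 / 125) (21 / 250)`, every infinite-volume limit state of the perturbed torus states of its periodised family equals every
DLR state, and such limit states exist. [folklore] -/
theorem su3_vanHove_oneState_dim3_starPV_twoFifths :
    ∀ (W : Potential (ZdEdge 3) (SUN 3)) (hW : MemBallZdW (1 / 100) (21 / 125) (21 / 250) W),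
      (∀ μ ∈ perturbedLimitPoints (2 / 15) (periodisedFamilyS W hW.dependsOn hW.gaugeInvariant hW.continuous),
        ∀ ν ∈ perturbedGibbsMeasuresS (d := 3) (fundamentalRep (Fin 3)) (2 / 15) W, μ = ν) ∧
      ∃ μ ∈ perturbedLimitPoints (2 / 15) (periodisedFamilyS W hW.dependsOn hW.gaugeInvariant hW.continuous),
        μ ∈ perturbedGibbsMeasuresS (d := 3) (fundamentalRep (Fin 3)) (2 / 15) W := by
  intro W hW
  have e : ((3 : ℕ) : ℝ) * (2 / 45 : ℝ) = 2 / 15 := by norm_num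
  refine ⟨fun μ hμ ν hν => ?_, exists_limitState_onBallZdW _ hW⟩
  rw [← e] at hμ hν
  exact oneState_onBallZdW su3_massGapOnBallZdW_dim3_starPV_twoFifths hW hμ hν

/-- **VAN HOVE = THE ONE STATE**, `SU(3)`, `ℤ³`, cell `β_W = 9 / 20` ('t Hooft `1 / 20`, tree coupling `3 / 20`): for every member of
`MemBallZdW (1/100) (37 / 500) (37 / 1000)`, every infinite-volume limit state of the perturbed torus states of its periodised family equals every
DLR state, and such limit states exist. [folklore] -/
theorem su3_vanHove_oneState_dim3_starPV_nineTwentieths :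
    ∀ (W : Potential (ZdEdge 3) (SUN 3)) (hW : MemBallZdW (1 / 100) (37 / 500) (37 / 1000) W),
      (∀ μ ∈ perturbedLimitPoints (3 / 20) (periodisedFamilyS W hW.dependsOn hW.gaugeInvariant hW.continuous),
        ∀ ν ∈ perturbedGibbsMeasuresS (d := 3) (fundamentalRep (Fin 3)) (3 / 20) W, μ = ν) ∧
      ∃ μ ∈ perturbedLimitPoints (3 / 20) (periodisedFamilyS W hW.dependsOn hW.gaugeInvariant hW.continuous),
        μ ∈ perturbedGibbsMeasuresS (d := 3) (fundamentalRep (Fin 3)) (3 / 20) W := by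
  intro W hW
  have e : ((3 : ℕ) : ℝ) * (1 / 20 : ℝ) = 3 / 20 := by norm_num
  refine ⟨fun μ hμ ν hν => ?_, exists_limitState_onBallZdW _ hW⟩
  rw [← e] at hμ hν
  exact oneState_onBallZdW su3_massGapOnBallZdW_dim3_starPV_nineTwentieths hW hμ hν

/-! ### Every `N ≥ 2`, `ℤ⁴` -/

/-- **VAN HOVE = THE ONE STATE, EVERY `N ≥ 2`**, `ℤ⁴`, 't Hooft cell `1 / 64` (tree coupling `N·(1 / 64)`): for every member of
`MemBallZdW (1/100) (177 / 500) (177 / 1000)`, every infinite-volume limit state of the perturbed torus states of its periodised family equals every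
DLR state, and such limit states exist. [folklore] -/
theorem suN_vanHove_oneState_star_64 (hN : 2 ≤ N) :
    ∀ (W : Potential (ZdEdge 4) (SUN N)) (hW : MemBallZdW (1 / 100) (177 / 500) (177 / 1000) W),
      (∀ μ ∈ perturbedLimitPoints ((N : ℝ) * (1 / 64)) (periodisedFamilyS W hW.dependsOn hW.gaugeInvariant hW.continuous),
        ∀ ν ∈ perturbedGibbsMeasuresS (d := 4) (fundamentalRep (Fin N)) ((N : ℝ) * (1 / 64)) W, μ = ν) ∧
      ∃ μ ∈ perturbedLimitPoints ((N : ℝ) * (1 / 64)) (periodisedFamilyS W hW.dependsOn hW.gaugeInvariant hW.continuous),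
        μ ∈ perturbedGibbsMeasuresS (d := 4) (fundamentalRep (Fin N)) ((N : ℝ) * (1 / 64)) W := fun _ hW =>
  ⟨fun _ hμ _ hν => oneState_onBallZdW (suN_massGapOnBallZdW_star_64 hN) hW hμ hν, exists_limitState_onBallZdW _ hW⟩

/-- **VAN HOVE = THE ONE STATE, EVERY `N ≥ 2`**, `ℤ⁴`, 't Hooft cell `1 / 48` (tree coupling `N·(1 / 48)`): for every member of
`MemBallZdW (1/100) (23 / 100) (23 / 200)`, every infinite-volume limit state of the perturbed torus states of its periodised family equals every
DLR state, and such limit states exist. [folklore] -/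
theorem suN_vanHove_oneState_star_48 (hN : 2 ≤ N) :
    ∀ (W : Potential (ZdEdge 4) (SUN N)) (hW : MemBallZdW (1 / 100) (23 / 100) (23 / 200) W),
      (∀ μ ∈ perturbedLimitPoints ((N : ℝ) * (1 / 48)) (periodisedFamilyS W hW.dependsOn hW.gaugeInvariant hW.continuous),
        ∀ ν ∈ perturbedGibbsMeasuresS (d := 4) (fundamentalRep (Fin N)) ((N : ℝ) * (1 / 48)) W, μ = ν) ∧
      ∃ μ ∈ perturbedLimitPoints ((N : ℝ) * (1 / 48)) (periodisedFamilyS W hW.dependsOn hW.gaugeInvariant hW.continuous),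
        μ ∈ perturbedGibbsMeasuresS (d := 4) (fundamentalRep (Fin N)) ((N : ℝ) * (1 / 48)) W := fun _ hW =>
  ⟨fun _ hμ _ hν => oneState_onBallZdW (suN_massGapOnBallZdW_star_48 hN) hW hμ hν, exists_limitState_onBallZdW _ hW⟩

/-- **VAN HOVE = THE ONE STATE, EVERY `N ≥ 2`**, `ℤ⁴`, 't Hooft cell `1 / 40` (tree coupling `N·(1 / 40)`): for every member of
`MemBallZdW (1/100) (3 / 25) (3 / 50)`, every infinite-volume limit state of the perturbed torus states of its periodised family equals every
DLR state, and such limit states exist. [folklore] -/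
theorem suN_vanHove_oneState_star_40 (hN : 2 ≤ N) :
    ∀ (W : Potential (ZdEdge 4) (SUN N)) (hW : MemBallZdW (1 / 100) (3 / 25) (3 / 50) W),
      (∀ μ ∈ perturbedLimitPoints ((N : ℝ) * (1 / 40)) (periodisedFamilyS W hW.dependsOn hW.gaugeInvariant hW.continuous),
        ∀ ν ∈ perturbedGibbsMeasuresS (d := 4) (fundamentalRep (Fin N)) ((N : ℝ) * (1 / 40)) W, μ = ν) ∧
      ∃ μ ∈ perturbedLimitPoints ((N : ℝ) * (1 / 40)) (periodisedFamilyS W hW.dependsOn hW.gaugeInvariant hW.continuous),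
        μ ∈ perturbedGibbsMeasuresS (d := 4) (fundamentalRep (Fin N)) ((N : ℝ) * (1 / 40)) W := fun _ hW =>
  ⟨fun _ hμ _ hν => oneState_onBallZdW (suN_massGapOnBallZdW_star_40 hN) hW hμ hν, exists_limitState_onBallZdW _ hW⟩

/-- **VAN HOVE = THE ONE STATE, EVERY `N ≥ 2`**, `ℤ⁴`, 't Hooft cell `1 / 36` (tree coupling `N·(1 / 36)`): for every member of
`MemBallZdW (1/100) (21 / 500) (21 / 1000)`, every infinite-volume limit state of the perturbed torus states of its periodised family equals every
DLR state, and such limit states exist. [folklore] -/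
theorem suN_vanHove_oneState_star_36 (hN : 2 ≤ N) :
    ∀ (W : Potential (ZdEdge 4) (SUN N)) (hW : MemBallZdW (1 / 100) (21 / 500) (21 / 1000) W),
      (∀ μ ∈ perturbedLimitPoints ((N : ℝ) * (1 / 36)) (periodisedFamilyS W hW.dependsOn hW.gaugeInvariant hW.continuous),
        ∀ ν ∈ perturbedGibbsMeasuresS (d := 4) (fundamentalRep (Fin N)) ((N : ℝ) * (1 / 36)) W, μ = ν) ∧
      ∃ μ ∈ perturbedLimitPoints ((N : ℝ) * (1 / 36)) (periodisedFamilyS W hW.dependsOn hW.gaugeInvariant hW.continuous),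
        μ ∈ perturbedGibbsMeasuresS (d := 4) (fundamentalRep (Fin N)) ((N : ℝ) * (1 / 36)) W := fun _ hW =>
  ⟨fun _ hμ _ hν => oneState_onBallZdW (suN_massGapOnBallZdW_star_36 hN) hW hμ hν, exists_limitState_onBallZdW _ hW⟩

/-! ### Every `N ≥ 2`, `ℤ³` -/

/-- **VAN HOVE = THE ONE STATE, EVERY `N ≥ 2`**, `ℤ³`, 't Hooft cell `1 / 40` (tree coupling `N·(1 / 40)`): for every member of
`MemBallZdW (1/100) (167 / 500) (167 / 1000)`, every infinite-volume limit state of the perturbed torus states of its periodised family equals every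
DLR state, and such limit states exist. [folklore] -/
theorem suN_vanHove_oneState_dim3_star_40 (hN : 2 ≤ N) :
    ∀ (W : Potential (ZdEdge 3) (SUN N)) (hW : MemBallZdW (1 / 100) (167 / 500) (167 / 1000) W),
      (∀ μ ∈ perturbedLimitPoints ((N : ℝ) * (1 / 40)) (periodisedFamilyS W hW.dependsOn hW.gaugeInvariant hW.continuous),
        ∀ ν ∈ perturbedGibbsMeasuresS (d := 3) (fundamentalRep (Fin N)) ((N : ℝ) * (1 / 40)) W, μ = ν) ∧
      ∃ μ ∈ perturbedLimitPoints ((N : ℝ) * (1 / 40)) (periodisedFamilyS W hW.dependsOn hW.gaugeInvariant hW.continuous),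
        μ ∈ perturbedGibbsMeasuresS (d := 3) (fundamentalRep (Fin N)) ((N : ℝ) * (1 / 40)) W := fun _ hW =>
  ⟨fun _ hμ _ hν => oneState_onBallZdW (suN_massGapOnBallZdW_dim3_star_40 hN) hW hμ hν, exists_limitState_onBallZdW _ hW⟩

/-- **VAN HOVE = THE ONE STATE, EVERY `N ≥ 2`**, `ℤ³`, 't Hooft cell `1 / 32` (tree coupling `N·(1 / 32)`): for every member of
`MemBallZdW (1/100) (119 / 500) (119 / 1000)`, every infinite-volume limit state of the perturbed torus states of its periodised family equals every
DLR state, and such limit states exist. [folklore] -/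
theorem suN_vanHove_oneState_dim3_star_32 (hN : 2 ≤ N) :
    ∀ (W : Potential (ZdEdge 3) (SUN N)) (hW : MemBallZdW (1 / 100) (119 / 500) (119 / 1000) W),
      (∀ μ ∈ perturbedLimitPoints ((N : ℝ) * (1 / 32)) (periodisedFamilyS W hW.dependsOn hW.gaugeInvariant hW.continuous),
        ∀ ν ∈ perturbedGibbsMeasuresS (d := 3) (fundamentalRep (Fin N)) ((N : ℝ) * (1 / 32)) W, μ = ν) ∧
      ∃ μ ∈ perturbedLimitPoints ((N : ℝ) * (1 / 32)) (periodisedFamilyS W hW.dependsOn hW.gaugeInvariant hW.continuous),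
        μ ∈ perturbedGibbsMeasuresS (d := 3) (fundamentalRep (Fin N)) ((N : ℝ) * (1 / 32)) W := fun _ hW =>
  ⟨fun _ hμ _ hν => oneState_onBallZdW (suN_massGapOnBallZdW_dim3_star_32 hN) hW hμ hν, exists_limitState_onBallZdW _ hW⟩

/-- **VAN HOVE = THE ONE STATE, EVERY `N ≥ 2`**, `ℤ³`, 't Hooft cell `1 / 28` (tree coupling `N·(1 / 28)`): for every member of
`MemBallZdW (1/100) (41 / 250) (41 / 500)`, every infinite-volume limit state of the perturbed torus states of its periodised family equals every
DLR state, and such limit states exist. [folklore] -/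
theorem suN_vanHove_oneState_dim3_star_28 (hN : 2 ≤ N) :
    ∀ (W : Potential (ZdEdge 3) (SUN N)) (hW : MemBallZdW (1 / 100) (41 / 250) (41 / 500) W),
      (∀ μ ∈ perturbedLimitPoints ((N : ℝ) * (1 / 28)) (periodisedFamilyS W hW.dependsOn hW.gaugeInvariant hW.continuous),
        ∀ ν ∈ perturbedGibbsMeasuresS (d := 3) (fundamentalRep (Fin N)) ((N : ℝ) * (1 / 28)) W, μ = ν) ∧
      ∃ μ ∈ perturbedLimitPoints ((N : ℝ) * (1 / 28)) (periodisedFamilyS W hW.dependsOn hW.gaugeInvariant hW.continuous),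
        μ ∈ perturbedGibbsMeasuresS (d := 3) (fundamentalRep (Fin N)) ((N : ℝ) * (1 / 28)) W := fun _ hW =>
  ⟨fun _ hμ _ hν => oneState_onBallZdW (suN_massGapOnBallZdW_dim3_star_28 hN) hW hμ hν, exists_limitState_onBallZdW _ hW⟩

/-- **VAN HOVE = THE ONE STATE, EVERY `N ≥ 2`**, `ℤ³`, 't Hooft cell `1 / 24` (tree coupling `N·(1 / 24)`): for every member of
`MemBallZdW (1/100) (3 / 50) (3 / 100)`, every infinite-volume limit state of the perturbed torus states of its periodised family equals every
DLR state, and such limit states exist. [folklore] -/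
theorem suN_vanHove_oneState_dim3_star_24 (hN : 2 ≤ N) :
    ∀ (W : Potential (ZdEdge 3) (SUN N)) (hW : MemBallZdW (1 / 100) (3 / 50) (3 / 100) W),
      (∀ μ ∈ perturbedLimitPoints ((N : ℝ) * (1 / 24)) (periodisedFamilyS W hW.dependsOn hW.gaugeInvariant hW.continuous),
        ∀ ν ∈ perturbedGibbsMeasuresS (d := 3) (fundamentalRep (Fin N)) ((N : ℝ) * (1 / 24)) W, μ = ν) ∧
      ∃ μ ∈ perturbedLimitPoints ((N : ℝ) * (1 / 24)) (periodisedFamilyS W hW.dependsOn hW.gaugeInvariant hW.continuous),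
        μ ∈ perturbedGibbsMeasuresS (d := 3) (fundamentalRep (Fin N)) ((N : ℝ) * (1 / 24)) W := fun _ hW =>
  ⟨fun _ hμ _ hν => oneState_onBallZdW (suN_massGapOnBallZdW_dim3_star_24 hN) hW hμ hν, exists_limitState_onBallZdW _ hW⟩

/-! ### `SU(3)`, `ℤ⁴`, FRONTIER cells (beyond `3/10`) -/

/-- **VAN HOVE = THE ONE STATE**, `SU(3)`, `ℤ⁴`, FRONTIER cell `β_W = 31 / 100` ('t Hooft `31 / 900`, tree coupling `31 / 300`): for every member of
`MemBallZdW (1/100) (1 / 50) (1 / 100)`, every infinite-volume limit state of the perturbed torus states of its periodised family equals every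
DLR state, and such limit states exist. [folklore] -/
theorem su3_vanHove_oneState_starPV_thirtyOneHundredths :
    ∀ (W : Potential (ZdEdge 4) (SUN 3)) (hW : MemBallZdW (1 / 100) (1 / 50) (1 / 100) W),
      (∀ μ ∈ perturbedLimitPoints (31 / 300) (periodisedFamilyS W hW.dependsOn hW.gaugeInvariant hW.continuous),
        ∀ ν ∈ perturbedGibbsMeasuresS (d := 4) (fundamentalRep (Fin 3)) (31 / 300) W, μ = ν) ∧
      ∃ μ ∈ perturbedLimitPoints (31 / 300) (periodisedFamilyS W hW.dependsOn hW.gaugeInvariant hW.continuous),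
        μ ∈ perturbedGibbsMeasuresS (d := 4) (fundamentalRep (Fin 3)) (31 / 300) W := by
  intro W hW
  have e : ((3 : ℕ) : ℝ) * (31 / 900 : ℝ) = 31 / 300 := by norm_num
  refine ⟨fun μ hμ ν hν => ?_, exists_limitState_onBallZdW _ hW⟩
  rw [← e] at hμ hν
  exact oneState_onBallZdW su3_massGapOnBallZdW_starPV_thirtyOneHundredths hW hμ hν

/-- **VAN HOVE = THE ONE STATE**, `SU(3)`, `ℤ⁴`, FRONTIER cell `β_W = 63 / 200` ('t Hooft `7 / 200`, tree coupling `21 / 200`): for every member of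
`MemBallZdW (1/100) (1 / 250) (1 / 500)`, every infinite-volume limit state of the perturbed torus states of its periodised family equals every
DLR state, and such limit states exist. [folklore] -/
theorem su3_vanHove_oneState_starPV_sixtyThreeTwoHundredths :
    ∀ (W : Potential (ZdEdge 4) (SUN 3)) (hW : MemBallZdW (1 / 100) (1 / 250) (1 / 500) W),
      (∀ μ ∈ perturbedLimitPoints (21 / 200) (periodisedFamilyS W hW.dependsOn hW.gaugeInvariant hW.continuous),
        ∀ ν ∈ perturbedGibbsMeasuresS (d := 4) (fundamentalRep (Fin 3)) (21 / 200) W, μ = ν) ∧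
      ∃ μ ∈ perturbedLimitPoints (21 / 200) (periodisedFamilyS W hW.dependsOn hW.gaugeInvariant hW.continuous),
        μ ∈ perturbedGibbsMeasuresS (d := 4) (fundamentalRep (Fin 3)) (21 / 200) W := by
  intro W hW
  have e : ((3 : ℕ) : ℝ) * (7 / 200 : ℝ) = 21 / 200 := by norm_num
  refine ⟨fun μ hμ ν hν => ?_, exists_limitState_onBallZdW _ hW⟩
  rw [← e] at hμ hν
  exact oneState_onBallZdW su3_massGapOnBallZdW_starPV_sixtyThreeTwoHundredths hW hμ hν

/-- **VAN HOVE = THE ONE STATE**, `SU(3)`, `ℤ⁴`, FRONTIER cell `β_W = 317 / 1000` ('t Hooft `317 / 9000`, tree coupling `317 / 3000`): for every member of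
`MemBallZdW (1/100) (1 / 5000) (1 / 10000)`, every infinite-volume limit state of the perturbed torus states of its periodised family equals every
DLR state, and such limit states exist. [folklore] -/
theorem su3_vanHove_oneState_starPV_threeSeventeenThousandths :
    ∀ (W : Potential (ZdEdge 4) (SUN 3)) (hW : MemBallZdW (1 / 100) (1 / 5000) (1 / 10000) W),
      (∀ μ ∈ perturbedLimitPoints (317 / 3000) (periodisedFamilyS W hW.dependsOn hW.gaugeInvariant hW.continuous),
        ∀ ν ∈ perturbedGibbsMeasuresS (d := 4) (fundamentalRep (Fin 3)) (317 / 3000) W, μ = ν) ∧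
      ∃ μ ∈ perturbedLimitPoints (317 / 3000) (periodisedFamilyS W hW.dependsOn hW.gaugeInvariant hW.continuous),
        μ ∈ perturbedGibbsMeasuresS (d := 4) (fundamentalRep (Fin 3)) (317 / 3000) W := by
  intro W hW
  have e : ((3 : ℕ) : ℝ) * (317 / 9000 : ℝ) = 317 / 3000 := by norm_num
  refine ⟨fun μ hμ ν hν => ?_, exists_limitState_onBallZdW _ hW⟩
  rw [← e] at hμ hν
  exact oneState_onBallZdW su3_massGapOnBallZdW_starPV_threeSeventeenThousandths hW hμ hν

/-! ### Every `N ≥ 2`, `ℤ⁴`, FRONTIER cells (beyond 't Hooft `1/36`) -/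

/-- **VAN HOVE = THE ONE STATE, EVERY `N ≥ 2`**, `ℤ⁴`, FRONTIER 't Hooft cell `1 / 35`: for every member of `MemBallZdW (1/100) (2 / 125) (1 / 125)`,
every infinite-volume limit state of the perturbed torus states of its periodised family equals every DLR state, and such limit states
exist. [folklore] -/
theorem suN_vanHove_oneState_star_35 (hN : 2 ≤ N) :
    ∀ (W : Potential (ZdEdge 4) (SUN N)) (hW : MemBallZdW (1 / 100) (2 / 125) (1 / 125) W),
      (∀ μ ∈ perturbedLimitPoints ((N : ℝ) * (1 / 35)) (periodisedFamilyS W hW.dependsOn hW.gaugeInvariant hW.continuous),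
        ∀ ν ∈ perturbedGibbsMeasuresS (d := 4) (fundamentalRep (Fin N)) ((N : ℝ) * (1 / 35)) W, μ = ν) ∧
      ∃ μ ∈ perturbedLimitPoints ((N : ℝ) * (1 / 35)) (periodisedFamilyS W hW.dependsOn hW.gaugeInvariant hW.continuous),
        μ ∈ perturbedGibbsMeasuresS (d := 4) (fundamentalRep (Fin N)) ((N : ℝ) * (1 / 35)) W := fun _ hW =>
  ⟨fun _ hμ _ hν => oneState_onBallZdW (suN_massGapOnBallZdW_star_35 hN) hW hμ hν, exists_limitState_onBallZdW _ hW⟩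

/-- **VAN HOVE = THE ONE STATE, EVERY `N ≥ 2`**, `ℤ⁴`, FRONTIER 't Hooft cell `2 / 69`: for every member of `MemBallZdW (1/100) (1 / 250) (1 / 500)`,
every infinite-volume limit state of the perturbed torus states of its periodised family equals every DLR state, and such limit states
exist. [folklore] -/
theorem suN_vanHove_oneState_star_2_69 (hN : 2 ≤ N) :
    ∀ (W : Potential (ZdEdge 4) (SUN N)) (hW : MemBallZdW (1 / 100) (1 / 250) (1 / 500) W),
      (∀ μ ∈ perturbedLimitPoints ((N : ℝ) * (2 / 69)) (periodisedFamilyS W hW.dependsOn hW.gaugeInvariant hW.continuous),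
        ∀ ν ∈ perturbedGibbsMeasuresS (d := 4) (fundamentalRep (Fin N)) ((N : ℝ) * (2 / 69)) W, μ = ν) ∧
      ∃ μ ∈ perturbedLimitPoints ((N : ℝ) * (2 / 69)) (periodisedFamilyS W hW.dependsOn hW.gaugeInvariant hW.continuous),
        μ ∈ perturbedGibbsMeasuresS (d := 4) (fundamentalRep (Fin N)) ((N : ℝ) * (2 / 69)) W := fun _ hW =>
  ⟨fun _ hμ _ hν => oneState_onBallZdW (suN_massGapOnBallZdW_star_2_69 hN) hW hμ hν, exists_limitState_onBallZdW _ hW⟩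

/-- **VAN HOVE = THE ONE STATE, EVERY `N ≥ 2`**, `ℤ⁴`, FRONTIER 't Hooft cell `7 / 240`: for every member of `MemBallZdW (1/100) (1 / 5000) (1 / 10000)`,
every infinite-volume limit state of the perturbed torus states of its periodised family equals every DLR state, and such limit states
exist. [folklore] -/
theorem suN_vanHove_oneState_star_7_240 (hN : 2 ≤ N) :
    ∀ (W : Potential (ZdEdge 4) (SUN N)) (hW : MemBallZdW (1 / 100) (1 / 5000) (1 / 10000) W),
      (∀ μ ∈ perturbedLimitPoints ((N : ℝ) * (7 / 240)) (periodisedFamilyS W hW.dependsOn hW.gaugeInvariant hW.continuous),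
        ∀ ν ∈ perturbedGibbsMeasuresS (d := 4) (fundamentalRep (Fin N)) ((N : ℝ) * (7 / 240)) W, μ = ν) ∧
      ∃ μ ∈ perturbedLimitPoints ((N : ℝ) * (7 / 240)) (periodisedFamilyS W hW.dependsOn hW.gaugeInvariant hW.continuous),
        μ ∈ perturbedGibbsMeasuresS (d := 4) (fundamentalRep (Fin N)) ((N : ℝ) * (7 / 240)) W := fun _ hW =>
  ⟨fun _ hμ _ hν => oneState_onBallZdW (suN_massGapOnBallZdW_star_7_240 hN) hW hμ hν, exists_limitState_onBallZdW _ hW⟩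

end Summit.Ventures.YMGap.RobustBall

end
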